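import Literature.NumberTheory.EllipticCurves.Kato2004.IwasawaH1Reduction
import Literature.NumberTheory.EllipticCurves.SelmerInftyTorsionFiniteProofs
import HarnessLib

/-!
# From the layers `K_n` to `K_∞`: `res_{K_∞} y = 0 ⇒ res_{K_m} y = 0` for some finite `m`, and the
# (definitional) bridge `H¹(Γ_∞, E[p])` of the stub ↔ `Kato2004.H1 (E[p]) Γ_∞`

Topic `NumberTheory/EllipticCurves`, sub-directory `Kato2004`.  Cell `bsd-smallim` (rung K6 of
`BirchSwinnertonDyer`, crux `MuTransferX9` = item 19276, open stub `stub_coreX9`), seat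
`bsd-smallim-k6-ty` (typer), CORE-PLAN S2.1 / S0.4: the conclusion of `stub_coreX9` lives in
`subgroupH1 κ.kerSubgroup (E[p]) = H¹(K_∞, E[p]) = lim→_n H¹(K_n, E[p])`, while the Shapiro dictionary
(`IwasawaTwistModPShapiro*`) speaks about the finite layers `H¹(Γ_n, E[p])`.  This file supplies:

* (generic `ZpExtension`, any discrete `Γ_K`-module) `mem_kerSubgroup_of_forall_mem_layerSubgroup`
  (`⋂_n Γ_n = Γ_∞`) and **`exists_resLe_layerSubgroup_eq_zero`**: if `c ∈ H¹(Γ_n, M)` restricts to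
  `0` in `H¹(Γ_∞, M)`, then already `res_{Γ_m}^{Γ_n} c = 0` for some `m ≥ n` (the zero set of
  `φ − ∂a` is an open subgroup containing `Γ_∞ = ⋂ Γ_m`, compactness) — the injectivity half of
  `H¹(Γ_∞, M) = lim→ H¹(Γ_n, M)`. [Serre, I §2.2 Prop. 8]
* (`E[p]`) the identifications, all `rfl`: `subgroupH1 U (E[p]) = H1 (E[p]) U` as types, the stub's
  `conjH1` is `conjMap`, and `resOfLe` is `resLe` (`conjH1_torsion_eq_conjMap`, `resOfLe_torsion_eq_resLe`).

## References

* J.-P. Serre, *Galois Cohomology* (1997), I §2.2, Prop. 8 (`H^q(lim← G_i, lim→ A_i) = lim→ H^q`).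
  [SerreGaloisCohomology1997]
* K. Kato, Astérisque 295 (2004), §13.8 (p. 228). [Kato2004Asterisque]
-/

noncomputable section

open scoped NumberField Topology
open Field CategoryTheory Filter
open Literature.NumberTheory.GaloisRepresentations
open Literature.NumberTheory.EllipticCurves
open WeierstrassCurve (geomPoints geomTorsion)

universe u

/-! ## `⋂ Γ_n = Γ_∞` and the injectivity half of `H¹(Γ_∞) = lim→ H¹(Γ_n)` -/

namespace Literature.NumberTheory.EllipticCurves.ZpExtension

variable {K : Type u} [Field K] {p : ℕ} [Fact p.Prime] (κ : ZpExtension K p)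
variable {M : Type u} [AddCommGroup M] [TopologicalSpace M] [DiscreteTopology M]
variable (ρ : DiscreteGaloisModule K M)

/-- `⋂_n Γ_n = Γ_∞`: an element of every layer subgroup lies in the kernel of `κ`
(`⋂_n p^n ℤ_p = 0`, Krull). [cite: SerreGaloisCohomology1997, I §2.2] -/
theorem mem_kerSubgroup_of_forall_mem_layerSubgroup {g : absoluteGaloisGroup K}
    (hg : ∀ m, g ∈ κ.layerSubgroup m) : g ∈ κ.kerSubgroup := by
  rw [mem_kerSubgroup]
  have hx : (κ g).toAdd ∈ (⨅ m : ℕ, (IsLocalRing.maximalIdeal ℤ_[p]) ^ m) := by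
    refine Ideal.mem_iInf.2 fun m ↦ ?_
    rw [PadicInt.maximalIdeal_eq_span_p, Ideal.span_singleton_pow, Ideal.mem_span_singleton]
    exact mem_layerSubgroup.1 (hg m)
  rw [Ideal.iInf_pow_eq_bot_of_isLocalRing _ (Ideal.IsMaximal.ne_top inferInstance),
    Ideal.mem_bot] at hx
  rw [← ofAdd_toAdd (κ g), hx, ofAdd_zero]

/-- **Injectivity half of `H¹(Γ_∞, M) = lim→_n H¹(Γ_n, M)`.**  If `c ∈ H¹(Γ_n, M)` restricts to zero
on `Γ_∞ = ker κ`, then `res_{Γ_m}^{Γ_n} c = 0` for some `m ≥ n`: writing `c = [φ]` and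
`φ|_{Γ_∞} = ∂a`, the locus `{φ = ∂a} ⊆ Γ_n` is open and contains `Γ_∞ = ⋂_m Γ_m`, hence some `Γ_m`
(compactness of `Γ_K`). [cite: SerreGaloisCohomology1997, I §2.2 Prop. 8] -/
theorem exists_resLe_layerSubgroup_eq_zero [CompactSpace (absoluteGaloisGroup K)] {n : ℕ}
    (c : continuousCohomology 1 (subgroupRep ρ.toTopRep (κ.layerSubgroup n)))
    (hc : resLe ρ.toTopRep (κ.kerSubgroup_le_layerSubgroup n) 1 c = 0) :
    ∃ m, ∃ hm : n ≤ m, resLe ρ.toTopRep (κ.layerSubgroup_antitone hm) 1 c = 0 := by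
  classical
  obtain ⟨φ, rfl⟩ := oneCocycleClass_surjective _ c
  rw [resLe_oneCocycleClass, oneCocycleClass_eq_zero_iff] at hc
  obtain ⟨a, ha⟩ := hc
  have ha' : ∀ (g : absoluteGaloisGroup K) (hg : g ∈ κ.kerSubgroup),
      φ.1 ⟨g, κ.kerSubgroup_le_layerSubgroup n hg⟩ = ρ g a - a := fun g hg ↦ ha ⟨g, hg⟩
  -- the open locus `{φ = ∂a}` of `Γ_n`, as a subset of `Γ_K`
  let S : Set (κ.layerSubgroup n) := {x | φ.1 x = ρ (x : absoluteGaloisGroup K) a - a}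
  have hS : IsOpen S := by
    have h1 : S = (fun x : κ.layerSubgroup n ↦ φ.1 x - (ρ (x : absoluteGaloisGroup K) a - a)) ⁻¹' {0} := by
      ext x
      simp only [S, Set.mem_setOf_eq, Set.mem_preimage, Set.mem_singleton_iff, sub_eq_zero]
    rw [h1]
    exact (isOpen_discrete _).preimage (φ.1.continuous.sub
      (((ρ.continuous_apply_left a).comp continuous_subtype_val).sub continuous_const))
  have hZ : IsOpen (Subtype.val '' S) := (κ.isOpen_layerSubgroup n).isOpenMap_subtype_val S hS
  -- compactness: some `Γ_m` lies in the locus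
  obtain ⟨m, hm⟩ := exists_subset_nhds_of_compactSpace
    (V := fun m : ℕ ↦ (κ.layerSubgroup m : Set (absoluteGaloisGroup K)))
    (fun i j ↦ ⟨max i j, SetLike.coe_subset_coe.2 (κ.layerSubgroup_antitone (le_max_left i j)),
      SetLike.coe_subset_coe.2 (κ.layerSubgroup_antitone (le_max_right i j))⟩)
    (fun m ↦ (κ.layerSubgroup m).isClosed_of_isOpen (κ.isOpen_layerSubgroup m))
    (U := Subtype.val '' S) (fun x hx ↦ by
      have hker : x ∈ κ.kerSubgroup :=
        κ.mem_kerSubgroup_of_forall_mem_layerSubgroup fun m ↦ Set.mem_iInter.1 hx m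
      exact hZ.mem_nhds ⟨⟨x, κ.kerSubgroup_le_layerSubgroup n hker⟩, ha' x hker, rfl⟩)
  refine ⟨max m n, le_max_right m n, ?_⟩
  rw [resLe_oneCocycleClass, oneCocycleClass_eq_zero_iff]
  refine ⟨a, fun g ↦ ?_⟩
  obtain ⟨x, hxS, hxg⟩ := hm (κ.layerSubgroup_antitone (le_max_left m n) g.2)
  have hx : x = ⟨(g : absoluteGaloisGroup K), κ.layerSubgroup_antitone (le_max_right m n) g.2⟩ :=
    Subtype.ext hxg
  subst hx
  exact hxS

end Literature.NumberTheory.EllipticCurves.ZpExtension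

/-! ## The stub's `H¹(U, E[p])`, `conjH1`, `resOfLe` are `Kato2004.H1 (E[p]) U`, `conjMap`, `resLe` -/

namespace Literature.NumberTheory.EllipticCurves.Kato2004

variable {W : WeierstrassCurve ℚ} {p : ℕ}

/-- The stub's coefficient representation `discreteTopRep U (E[p])` (from the `MulAction` of `Γ_ℚ` on
`E(ℚ̄)[p]`) IS `subgroupRep (E[p] as discrete Galois module).toTopRep U` (definitional).
[cite: Kato2004Asterisque, §13.8 (p. 228)] -/
theorem discreteTopRep_torsion_eq (U : Subgroup (absoluteGaloisGroup ℚ)) :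
    discreteTopRep U (geomTorsion W (p : ℤ)) = subgroupRep (W.torsionGaloisModule (p : ℤ)).toTopRep U :=
  rfl

/-- The stub's conjugation action `conjH1 U (E[p]) σ` on `subgroupH1 U (E[p]) = H1 (E[p]) U` is
`conjMap … σ 1` (definitional). [cite: Kato2004Asterisque, §13.8 (p. 228)] -/
theorem conjH1_torsion_eq_conjMap (U : Subgroup (absoluteGaloisGroup ℚ)) [U.Normal]
    (σ : absoluteGaloisGroup ℚ) (c : H1 (W.torsionGaloisModule (p : ℤ)) U) :
    conjH1 U (geomTorsion W (p : ℤ)) σ c = conjMap (W.torsionGaloisModule (p : ℤ)).toTopRep U σ 1 c :=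
  rfl

/-- The stub's restriction `resOfLe (E[p]) h` is `resLe … h 1` (definitional).
[cite: Kato2004Asterisque, §13.8 (p. 228)] -/
theorem resOfLe_torsion_eq_resLe {U U' : Subgroup (absoluteGaloisGroup ℚ)} (h : U ≤ U')
    (c : H1 (W.torsionGaloisModule (p : ℤ)) U') :
    resOfLe (geomTorsion W (p : ℤ)) h c = resLe (W.torsionGaloisModule (p : ℤ)).toTopRep h 1 c :=
  rfl

end Literature.NumberTheory.EllipticCurves.Kato2004

end
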